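import Literature.Combinatorics.Sahi2008.UnitSquare
import HarnessLib

/-!
# Lieb–Sahi (2022), Theorems 3.11–3.13: Sahi's `E_n ≥ 0` for ALL `n` on the uniform `m × m` grid
# (the discrete form of Theorem 3.7, "positive monotone functions on the unit square")

CITATION HEADER.  Source: E. H. Lieb, S. Sahi, *On the extension of the FKG inequality to `n` functions*,
J. Math. Phys. **63** (2022) 043301 = arXiv:2107.09838 [LiebSahi2021], §3.4 (read 2026-08-19 from the
materialised arXiv text): "THEOREM 3.7. If `f^1,…,f^n` are positive and monotone on `[0,1]²` then
`E_n(f^1,…,f^n) ≥ 0`. As before we can deduce this from the special case of `χ_a` … LEMMA 3.8. It suffices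
to prove Theorem 3.7 for `χ_{a^1},…,χ_{a^n}`, `a^i ∈ 𝒜(m)`, for all `m`." and "THEOREM 3.11. If
`a^1,…,a^{n−2},b` are in `𝒜`; `S` is a subset of `Q_2`; and `χ_b χ_S = 0`, then
`E_n(χ_{a^1},…,χ_{a^{n−2}},χ_b,χ_S) ≤ 0`.  THEOREM 3.12. If `a^1,…,a^{n−2},b,c` are in `𝒜`; `b,c` have
descent at `i`; and `b_{i+1} ≤ c_{i+1}` then `E_n(a^1,…,a^{n−2},b,c⋆) ≤ E_n(a^1,…,a^{n−2},b,c)`.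
THEOREM 3.13. For all `a^1,…,a^n` in `𝒜` we have `E_n(a^1,…,a^n) ≥ 0`.  Proof: Let us write `A(n)`,
`B(n)` and `C(n)` for the assertions … it suffices to prove the implications `A(n−1) ∧ C(n−1) ⟹ A(n)`,
and `A(n) ⟹ B(n) ⟹ C(n)`, for all `n ≥ 2`" — with the proofs printed there (recursion Prop. 3.3 for
`A`; the single cell `S = S_{c⋆} ∖ S_c` for `B`; the extremal argument "let `ℳ` be the set of `n`-tuples
… for which `E_n(𝐚)` achieves its minimum, and let `𝒩` be the subset of `ℳ` for which `λ(𝐚)` achieves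
its maximum …" with Props. 3.9, 3.10 for `C`).

Setting = `UnitSquare.lean` (the 0-indexed grid `Fin m × Fin m` with the uniform weight `gridWeight m`,
`𝒜(m) = DSeq m`, `χ_a = chi a`; Prop. 3.10 = `sahiE_plus_add_minus`), on the tree's recursive `sahiE`
(`Functional.lean`: the recursion of Prop. 3.3 is the DEFINITION, peeling slot `0`; slots are permuted
freely by `Symmetry.sahiE_comp_perm`).

## What is proved (no named fact)

* `GoodA` — the hypothesis of Thm. 3.11 in symmetric form (one slot an arbitrary indicator `χ_S`, the
  others `χ`'s of `𝒜`, and some other slot disjoint from `S`); stable under slot permutations.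
* **`thmA_and_thmC`** — Thm. 3.11 (`A`) and Thm. 3.13 (`C`) for every `n`, by the printed induction
  (`A(n−1) ∧ C(n−1) ⟹ A(n) ⟹ B(n) ⟹ C(n)`, Thm. 3.12 (`B`) inlined); the constant-sequence case of
  Prop. 3.9 is the nested-events theorem `TotalOrder.sahiE_setInd_nonneg_of_total`.
* **`liebSahi_thm313`** — `0 ≤ E_n(χ_{a^1},…,χ_{a^n})` for all `n`, all `m ≥ 1`, all `a^i ∈ 𝒜(m)`, under
  the uniform weight: Sahi's conjecture `C_n` [Sahi2008, Conj. 5] for the monotone subsets of the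
  discretised unit square, every `n` — the first case of `C_n` in the tree beyond chains, cumulations
  and the cubes `m ≤ 4`.  (`UnitSquareSahi.lean` turns this into `SahiPositive (gridWeight m) n`.)
-/

noncomputable section

namespace Literature.Combinatorics.Sahi2008

namespace UnitSquare

open Finset Function

variable {m : ℕ}

/-! ### Descents exist for non-constant sequences; the potential `λ` -/

/-- A non-constant antitone sequence has a descent at some `i` (with `j = i + 1`).
[cite: LiebSahi2021, §2.1 (proof of Thm. 2.9: "If this is not the case, then `a`, say, has a descent at some `i`")] -/
theorem exists_descent (a : DSeq m) {p p' : Fin m} (h : a.1 p ≠ a.1 p') :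
    ∃ i j : Fin m, (j : ℕ) = i + 1 ∧ a.1 j < a.1 i := by
  by_contra hno
  push Not at hno
  have key : ∀ (q : ℕ) (hq : q < m), a.1 ⟨q, hq⟩ = a.1 ⟨0, by omega⟩ := by
    intro q
    induction q with
    | zero => intro hq; rfl
    | succ q ih =>
      intro hq
      have h1 := ih (by omega)
      have h2 : a.1 ⟨q, by omega⟩ ≤ a.1 ⟨q + 1, hq⟩ := hno ⟨q, by omega⟩ ⟨q + 1, hq⟩ rfl
      have h3 : a.1 ⟨q + 1, hq⟩ ≤ a.1 ⟨q, by omega⟩ := a.2 (Fin.mk_le_mk.2 (by omega))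
      rw [← h1]
      exact le_antisymm h3 h2
  exact h (by rw [show p = ⟨p.1, p.2⟩ from rfl, show p' = ⟨p'.1, p'.2⟩ from rfl, key p.1 p.2, key p'.1 p'.2])

/-- The row sum `a_1 + ⋯ + a_m` (`= m² E(a)`). [cite: LiebSahi2021, §2.1 (`E_1(a) = (a_1+⋯+a_m)/m²`)] -/
def rowSum (a : DSeq m) : ℕ := ∑ p, (a.1 p : ℕ)

/-- The potential `λ(𝐚) = E(a^1) + ⋯ + E(a^n)` of the extremal argument, scaled by `m²`.
[cite: LiebSahi2021, §3.4 (proof of B(n) ⇒ C(n): `λ(𝐚)`) and §2.1 (proof of Thm. 2.9)] -/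
def lam {N : ℕ} (t : Fin N → DSeq m) : ℕ := ∑ k, rowSum (t k)

/-- Row sum of an updated sequence (plumbing). [folklore] -/
private theorem sum_val_update (g : Fin m → Fin (m + 1)) (j : Fin m) (v : Fin (m + 1)) :
    ∑ p, ((update g j v p : Fin (m + 1)) : ℕ) + (g j : ℕ) = ∑ p, (g p : ℕ) + (v : ℕ) := by
  have h1 : (fun p => ((update g j v p : Fin (m + 1)) : ℕ)) = update (fun p => (g p : ℕ)) j (v : ℕ) := by
    funext p
    exact apply_update (fun _ (x : Fin (m + 1)) => (x : ℕ)) g j v p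
  have h2 : ∑ p, (g p : ℕ) = (g j : ℕ) + ∑ p ∈ univ \ {j}, (g p : ℕ) := by
    conv_lhs => rw [← update_eq_self j (fun p => (g p : ℕ)), sum_update_of_mem (mem_univ j)]
  rw [h1, sum_update_of_mem (mem_univ j), h2]
  ring

/-- `E(a⁺) > E(a)` at a descent: the row sum grows by `a_i − a_{i+1} > 0`.
[cite: LiebSahi2021, §2.1 (proof of Thm. 2.9: "since `E(a⁺) > E(a)`")] -/
theorem rowSum_lt_rowSum_plus (a : DSeq m) (i j : Fin m) (hij : (j : ℕ) = i + 1) (hd : a.1 j < a.1 i) :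
    rowSum a < rowSum (plus a i j hij) := by
  have h := sum_val_update a.1 j (a.1 i)
  have hd' : (a.1 j : ℕ) < a.1 i := hd
  unfold rowSum plus
  dsimp only
  omega

/-- `E(a⋆) > E(a)`: the row sum grows by `1`. [cite: LiebSahi2021, §2.1 (proof of Thm. 2.9: "since `E(a⋆) > E(a)`")] -/
theorem rowSum_lt_rowSum_star (a : DSeq m) (i j : Fin m) (hij : (j : ℕ) = i + 1) (hd : a.1 j < a.1 i) :
    rowSum a < rowSum (star a i j hij hd) := by
  have h := sum_val_update a.1 j ⟨(a.1 j : ℕ) + 1, by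
    have := (a.1 i).2; have h2 : (a.1 j : ℕ) < a.1 i := hd; omega⟩
  unfold rowSum star
  dsimp only at h ⊢
  omega

/-- The potential after updating one slot. [cite: LiebSahi2021, §3.4 (`λ(𝐚)`)] -/
theorem lam_update_lt {N : ℕ} (t : Fin N → DSeq m) (k : Fin N) {x : DSeq m} (hx : rowSum (t k) < rowSum x) :
    lam t < lam (update t k x) := by
  unfold lam
  have h1 : (fun k' => rowSum (update t k x k')) = update (fun k' => rowSum (t k')) k (rowSum x) := by
    funext k'
    exact apply_update (fun _ (y : DSeq m) => rowSum y) t k x k'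
  have h2 : ∑ k', rowSum (t k') = rowSum (t k) + ∑ k' ∈ univ \ {k}, rowSum (t k') := by
    conv_lhs => rw [← update_eq_self k (fun k' => rowSum (t k')), sum_update_of_mem (mem_univ k)]
  rw [h1, sum_update_of_mem (mem_univ k), h2]
  omega

/-- Constant sequences give NESTED sets `S_a` (vertical strips of heights `α`): the case settled by the
chain formula. [cite: LiebSahi2021, Prop. 3.9 (§3.4) and the end of the proof of Thm. 2.9] -/
theorem cells_subset_or_of_const {a b : DSeq m} (ha : ∀ p p', a.1 p = a.1 p') (hb : ∀ p p', b.1 p = b.1 p') :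
    cells a ⊆ cells b ∨ cells b ⊆ cells a := by
  by_cases h : ∃ p, b.1 p < a.1 p
  · obtain ⟨p₁, hp₁⟩ := h
    refine Or.inr fun x hx => ?_
    simp only [cells, mem_filter, mem_univ, true_and] at hx ⊢
    have h1 : (b.1 x.1 : ℕ) < a.1 x.1 := by
      have := ha x.1 p₁; have := hb x.1 p₁
      have h' : (b.1 p₁ : ℕ) < a.1 p₁ := hp₁
      rw [ha x.1 p₁, hb x.1 p₁]
      exact h'
    omega
  · push Not at h
    refine Or.inl fun x hx => ?_
    simp only [cells, mem_filter, mem_univ, true_and] at hx ⊢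
    have h1 : (a.1 x.1 : ℕ) ≤ b.1 x.1 := h x.1
    omega

/-- The empty indicator vanishes (plumbing). [folklore] -/
private theorem setInd_empty {α : Type*} [DecidableEq α] : setInd (∅ : Finset α) = 0 := by
  funext x
  simp [setInd_apply]

/-- An indicator vanishes only for the empty set (plumbing). [folklore] -/
private theorem setInd_eq_zero_iff {α : Type*} [DecidableEq α] (T : Finset α) : setInd T = 0 ↔ T = ∅ := by
  constructor
  · intro h
    ext x
    have hx := congrFun h x
    simp only [setInd_apply, Pi.zero_apply, ite_eq_right_iff, one_ne_zero, imp_false] at hx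
    simp [hx]
  · rintro rfl
    exact setInd_empty

/-! ### The hypothesis of Theorem 3.11 -/

/-- The families of Theorem 3.11, in symmetric form: some slot `j` holds the indicator `χ_S` of an
ARBITRARY set of cells, every other slot holds `χ_a` for some `a ∈ 𝒜(m)`, and some slot `j' ≠ j` is
disjoint from `S` (`χ_b χ_S = 0`). [cite: LiebSahi2021, Thm. 3.11 (§3.4)] -/
def GoodA {N : ℕ} (f : Fin N → Grid m → ℝ) : Prop :=
  ∃ (j : Fin N) (S : Finset (Grid m)), f j = setInd S ∧ (∀ k, k ≠ j → ∃ a : DSeq m, f k = chi a) ∧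
    ∃ j', j' ≠ j ∧ f j' * setInd S = 0

/-- The hypothesis of Theorem 3.11 is stable under permuting the slots ("by symmetry").
[cite: LiebSahi2021, Thm. 3.11 and its proof ("so by symmetry we can apply `A(n−1)`")] -/
theorem GoodA.comp_perm {N : ℕ} {f : Fin N → Grid m → ℝ} (h : GoodA f) (σ : Equiv.Perm (Fin N)) :
    GoodA (fun k => f (σ k)) := by
  obtain ⟨j, S, hj, hothers, j', hj', hdisj⟩ := h
  refine ⟨σ.symm j, S, by simpa using hj, fun k hk => hothers (σ k) fun h => hk ?_, σ.symm j',
    fun h => hj' (σ.symm.injective h), by simpa using hdisj⟩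
  rw [← h, Equiv.symm_apply_apply]

/-! ### Theorems 3.11–3.13 by the printed induction -/

/-- **Theorems 3.11 (`A`) and 3.13 (`C`) together**, for every `n`, by induction:
`A(n−1) ∧ C(n−1) ⟹ A(n)` (recursion at the slot of `χ_S`), `A(n) ⟹ B(n)` (Thm. 3.12: the single cell
`S_{c⋆} ∖ S_c` is disjoint from `S_b`), `B(n) ⟹ C(n)` (the extremal argument with the potential `λ`, the
averaging identity Prop. 3.10 and the constant case Prop. 3.9). [cite: LiebSahi2021, Thms. 3.11–3.13 and their proof (§3.4)] -/
theorem thmA_and_thmC (hm : 0 < m) : ∀ N : ℕ,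
    (∀ f : Fin N → Grid m → ℝ, GoodA f → sahiE (gridWeight m) N f ≤ 0) ∧
      (∀ t : Fin N → DSeq m, 0 ≤ sahiE (gridWeight m) N (fun k => chi (t k)))
  | 0 => ⟨fun _ ⟨j, _⟩ => j.elim0, fun t => by rw [sahiE_zero]⟩
  | 1 => by
    refine ⟨fun f ⟨j, S, _, _, j', hj', _⟩ => absurd (Subsingleton.elim j' j) hj', fun t => ?_⟩
    rw [sahiE_one_apply]
    exact ex_nonneg (gridWeight_nonneg m) (chi_nonneg (t 0))
  | N + 2 => by
    classical
    obtain ⟨hA, hC⟩ := thmA_and_thmC hm (N + 1)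
    -- A(N+2)
    have hA2 : ∀ f : Fin (N + 2) → Grid m → ℝ, GoodA f → sahiE (gridWeight m) (N + 2) f ≤ 0 := by
      intro f hf
      obtain ⟨j, S, hj, hothers, j', hj', hdisj⟩ := hf
      -- bring the slot of `χ_S` to the front
      set σ : Equiv.Perm (Fin (N + 2)) := Equiv.swap 0 j with hσ
      set f' : Fin (N + 2) → Grid m → ℝ := fun k => f (σ k) with hf'
      rw [← sahiE_comp_perm (gridWeight m) (N + 2) σ f, sahiE_succ_succ]
      have h0 : f' 0 = setInd S := by
        simp only [hf', hσ, Equiv.swap_apply_left, hj]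
      have htail : ∀ i : Fin (N + 1), ∃ a : DSeq m, f' i.succ = chi a := fun i =>
        hothers (σ i.succ) fun h => Fin.succ_ne_zero i (by
          have h2 : σ (σ i.succ) = σ j := by rw [h]
          rwa [hσ, Equiv.swap_apply_self, Equiv.swap_apply_right] at h2)
      choose a ha using htail
      have htail' : Fin.tail f' = fun i => chi (a i) := funext fun i => ha i
      -- the disjoint partner, as a tail index
      have hx : σ j' ≠ 0 := fun h => hj' (by
        have h2 : σ (σ j') = σ 0 := by rw [h]
        rwa [hσ, Equiv.swap_apply_self, Equiv.swap_apply_left] at h2)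
      obtain ⟨i', hi'⟩ : ∃ i' : Fin (N + 1), i'.succ = σ j' := ⟨(σ j').pred hx, Fin.succ_pred _ _⟩
      have hpartner : chi (a i') * setInd S = 0 := by
        rw [← ha i', hi']
        have : f' (σ j') = f j' := by
          simp only [hf']
          rw [hσ, Equiv.swap_apply_self]
        rw [this]
        exact hdisj
      -- every summand of the recursion is `≤ 0`
      have hterms : ∀ i : Fin (N + 1),
          sahiE (gridWeight m) (N + 1) (update (Fin.tail f') i (Fin.tail f' i * f' 0)) ≤ 0 := by
        intro i
        rw [htail', h0]
        dsimp only
        rw [chi_eq_setInd, setInd_mul]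
        by_cases hempty : cells (a i) ∩ S = ∅
        · rw [hempty, setInd_empty, sahiE_update_zero]
        · by_cases hii : i' = i
          · exfalso
            apply hempty
            subst hii
            rw [chi_eq_setInd, setInd_mul] at hpartner
            exact (setInd_eq_zero_iff _).1 hpartner
          · refine hA _ ⟨i, cells (a i) ∩ S, update_self _ _ _, fun k hk => ⟨a k, by rw [update_of_ne hk]⟩,
              i', hii, ?_⟩
            rw [update_of_ne hii, ← setInd_mul, ← chi_eq_setInd]
            calc chi (a i') * (chi (a i) * setInd S)
                = chi (a i) * (chi (a i') * setInd S) := by ring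
              _ = 0 := by rw [hpartner, mul_zero]
      have hlast : 0 ≤ sahiE (gridWeight m) (N + 1) (Fin.tail f') * ex (gridWeight m) (f' 0) := by
        rw [htail', h0]
        exact mul_nonneg (hC a) (ex_nonneg (gridWeight_nonneg m) (setInd_nonneg S))
      have hsum := sum_nonpos fun i (_ : i ∈ (univ : Finset (Fin (N + 1)))) => hterms i
      linarith
    -- B(N+2) (Thm. 3.12): raising `c = t k` to `c⋆` does not increase `E_n` when another slot `k'` has
    -- `b_{i+1} ≤ c_{i+1}` (the added cell lies outside `S_b`)
    have hB : ∀ (t : Fin (N + 2) → DSeq m) (k k' : Fin (N + 2)) (i j : Fin m) (hij : (j : ℕ) = i + 1)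
        (hd : (t k).1 j < (t k).1 i), k' ≠ k → (t k').1 j ≤ (t k).1 j →
        sahiE (gridWeight m) (N + 2) (fun l => chi (update t k (star (t k) i j hij hd) l)) ≤
          sahiE (gridWeight m) (N + 2) (fun l => chi (t l)) := by
      intro t k k' i j hij hd hkk' hle
      rw [chi_comp_update, chi_star, sahiE_update_add, update_eq_self]
      have hgood : GoodA (update (fun l => chi (t l)) k (setInd {starCell (t k) i j hd})) :=
        ⟨k, {starCell (t k) i j hd}, update_self _ _ _, fun l hl => ⟨t l, by rw [update_of_ne hl]⟩, k',
          hkk', by rw [update_of_ne hkk']; exact chi_mul_starCell_eq_zero (t k) (t k') i j hd hle⟩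
      linarith [hA2 _ hgood]
    -- C(N+2): the extremal argument
    have hC2 : ∀ t : Fin (N + 2) → DSeq m, 0 ≤ sahiE (gridWeight m) (N + 2) (fun k => chi (t k)) := by
      set E : (Fin (N + 2) → DSeq m) → ℝ := fun t => sahiE (gridWeight m) (N + 2) fun k => chi (t k)
        with hE
      obtain ⟨t₁, -, ht₁⟩ := exists_min_image univ E univ_nonempty
      set M : Finset (Fin (N + 2) → DSeq m) := univ.filter fun t => E t = E t₁ with hM
      have hMne : M.Nonempty := ⟨t₁, by simp [hM]⟩
      obtain ⟨t₀, ht₀M, ht₀⟩ := exists_max_image M lam hMne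
      have hE0 : E t₀ = E t₁ := (mem_filter.1 ht₀M).2
      have hmin : ∀ t, E t₀ ≤ E t := fun t => hE0 ▸ ht₁ t (mem_univ _)
      have hmax : ∀ t, E t = E t₀ → lam t ≤ lam t₀ := fun t ht =>
        ht₀ t (mem_filter.2 ⟨mem_univ _, ht.trans hE0⟩)
      -- the minimiser `t₀` consists of constant sequences
      have hconst : ∀ k p p', (t₀ k).1 p = (t₀ k).1 p' := by
        by_contra hnc
        push Not at hnc
        obtain ⟨k, p, p', hne⟩ := hnc
        obtain ⟨i, j, hij, hd⟩ := exists_descent (t₀ k) hne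
        by_cases hothers : ∀ k', k' ≠ k → (t₀ k').1 i = (t₀ k').1 j
        · -- averaging (Prop. 3.10): `E(t⁺) = E(t₀)` and `λ` grows
          have havg := sahiE_plus_add_minus t₀ k i j hij hothers
          have h1 := hmin (update t₀ k (plus (t₀ k) i j hij))
          have h2 := hmin (update t₀ k (minus (t₀ k) i j hij))
          have heq : E (update t₀ k (plus (t₀ k) i j hij)) = E t₀ := by
            simp only [hE] at h1 h2 ⊢
            linarith
          have hl := hmax _ heq
          exact absurd hl (not_le.2 (lam_update_lt t₀ k (rowSum_lt_rowSum_plus (t₀ k) i j hij hd)))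
        · push Not at hothers
          obtain ⟨k', hk', hne'⟩ := hothers
          have hd' : (t₀ k').1 j < (t₀ k').1 i :=
            lt_of_le_of_ne ((t₀ k').2 (Fin.le_iff_val_le_val.2 (by omega))) (Ne.symm hne')
          rcases le_total ((t₀ k').1 j) ((t₀ k).1 j) with hle | hle
          · -- raise `t₀ k` (Thm. 3.12 with `b = t₀ k'`)
            have heq : E (update t₀ k (star (t₀ k) i j hij hd)) = E t₀ :=
              le_antisymm (hB t₀ k k' i j hij hd hk' hle) (hmin _)
            exact absurd (hmax _ heq)
              (not_le.2 (lam_update_lt t₀ k (rowSum_lt_rowSum_star (t₀ k) i j hij hd)))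
          · -- raise `t₀ k'` (Thm. 3.12 with `b = t₀ k`)
            have heq : E (update t₀ k' (star (t₀ k') i j hij hd')) = E t₀ :=
              le_antisymm (hB t₀ k' k i j hij hd' (Ne.symm hk') hle) (hmin _)
            exact absurd (hmax _ heq)
              (not_le.2 (lam_update_lt t₀ k' (rowSum_lt_rowSum_star (t₀ k') i j hij hd')))
      -- constant sequences: nested sets, Prop. 3.9 / the chain formula
      intro t
      refine le_trans ?_ (hmin t)
      have hfun : (fun k => chi (t₀ k)) = fun k => setInd (cells (t₀ k)) := funext fun k => chi_eq_setInd _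
      show 0 ≤ sahiE (gridWeight m) (N + 2) fun k => chi (t₀ k)
      rw [hfun]
      exact sahiE_setInd_nonneg_of_total (gridWeight_nonneg m) (sum_gridWeight hm) (fun k => cells (t₀ k))
        fun k k' => cells_subset_or_of_const (hconst k) (hconst k')
    exact ⟨hA2, hC2⟩

/-- **Lieb–Sahi, Theorem 3.13** (= Theorem 3.7 for the discretised unit square): for every `n`, every
`m ≥ 1` and all `a^1,…,a^n ∈ 𝒜(m)`, `0 ≤ E_n(χ_{a^1},…,χ_{a^n})` under the uniform weight on the `m × m`
grid — Sahi's conjecture `C_n` [Sahi2008, Conj. 5; LiebSahi2021, Conj. 1.1] for the monotone subsets of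
the unit square at every resolution `m`. [cite: LiebSahi2021, Thm. 3.13 and Thm. 3.7 (§3.4)] -/
theorem liebSahi_thm313 (hm : 0 < m) (n : ℕ) (t : Fin n → DSeq m) :
    0 ≤ sahiE (gridWeight m) n (fun k => chi (t k)) :=
  (thmA_and_thmC hm n).2 t

/-- **Lieb–Sahi, Theorem 3.11**: `E_n(χ_{a^1},…,χ_{a^{n−2}},χ_b,χ_S) ≤ 0` whenever `S` is any set of cells
with `χ_b χ_S = 0` (here in symmetric slot form, `GoodA`). [cite: LiebSahi2021, Thm. 3.11 (§3.4)] -/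
theorem liebSahi_thm311 (hm : 0 < m) (n : ℕ) (f : Fin n → Grid m → ℝ) (hf : GoodA f) :
    sahiE (gridWeight m) n f ≤ 0 :=
  (thmA_and_thmC hm n).1 f hf

end UnitSquare

end Literature.Combinatorics.Sahi2008
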